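import Mathlib
import Summits.Ventures.PercRepro2.SwOutCrossGenBitK

/-!
# Two cross components as one fibre on the disjoint-union graph: the link graph (blind cell
PercRepro2, night-4 g25, 2026-08-28; proofs/NIGHT4-G25.md §2)

Two dropped components `X₁`, `X₂` with cross graphs `G₁`, `G₂` at one junction are ONE dropped
structure with the cross graph `G₁ ⊕g G₂` on `X₁ ⊕ X₂` (Mathlib's disjoint sum: no edge between
the two parts).  A fibre point of the sum is a pair of fibre points (`glueKE`, `splitKE`,
`glueEquivKE`), and the LINK GRAPH of the sum is the two link graphs joined at `u`: a vertex of
`X₁` is attached in the sum iff it is attached in `G₁` (`attE_glue_inl`), two vertices of `X₁`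
are linked in the sum iff they are linked in `G₁` (`rlinkE_glue_inl_inl`), and a vertex of `X₁`
and a vertex of `X₂` are linked iff BOTH are attached (`rlinkE_glue_inl_inr`) — the link across
the components passes through `u`.  The transport is by the projection `Option (X₁ ⊕ X₂) →
Option X₁` (`u` and the other component to `u`), which sends adjacent vertices to equal or
adjacent ones (`reachable_of_adj_imp`), and by the embedding of `Option X₁`.  Consequences: the
red-side leak of the glued point is the disjunction of the leaks (`leakKE_glue`), the red edge
atoms are read componentwise (`redKEE_glue_*`), and the flip commutes with the gluing.
-/

namespace Summit.Ventures.PercRepro2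

namespace CrossArm

open Classical

section WeakHom

variable {α β : Type*} {G : SimpleGraph α} {G' : SimpleGraph β}

/-- A map sending adjacent vertices to equal or adjacent vertices preserves reachability. -/
lemma reachable_of_adj_imp (f : α → β) (hf : ∀ x y, G.Adj x y → f x = f y ∨ G'.Adj (f x) (f y))
    {u v : α} (h : G.Reachable u v) : G'.Reachable (f u) (f v) := by
  obtain ⟨p⟩ := h
  induction p with
  | nil => exact SimpleGraph.Reachable.refl _
  | cons hadj _ ih =>
    rcases hf _ _ hadj with heq | hadj'
    · rw [heq]; exact ih
    · exact (SimpleGraph.Adj.reachable hadj').trans ih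

end WeakHom

section Glue

variable {X₁ X₂ : Type*} (G₁ : SimpleGraph X₁) (G₂ : SimpleGraph X₂)

/-- The edge of the sum graph joining two vertices of the first part, as an edge of `G₁`. -/
lemma edgeSetSumEquiv_inl {i j : X₁} (h : s(Sum.inl i, Sum.inl j) ∈ (G₁ ⊕g G₂).edgeSet) :
    SimpleGraph.edgeSetSumEquiv (⟨s(Sum.inl i, Sum.inl j), h⟩ : (G₁ ⊕g G₂).edgeSet) =
      Sum.inl ⟨s(i, j), by simpa using h⟩ := rfl

/-- The edge of the sum graph joining two vertices of the second part, as an edge of `G₂`. -/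
lemma edgeSetSumEquiv_inr {i j : X₂} (h : s(Sum.inr i, Sum.inr j) ∈ (G₁ ⊕g G₂).edgeSet) :
    SimpleGraph.edgeSetSumEquiv (⟨s(Sum.inr i, Sum.inr j), h⟩ : (G₁ ⊕g G₂).edgeSet) =
      Sum.inr ⟨s(i, j), by simpa using h⟩ := rfl

/-- An edge of `G₁` as an edge of the sum graph. -/
lemma edgeSetSumEquiv_symm_inl {i j : X₁} (h : s(i, j) ∈ G₁.edgeSet) :
    (SimpleGraph.edgeSetSumEquiv (G := G₁) (H := G₂)).symm (Sum.inl ⟨s(i, j), h⟩) =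
      ⟨s(Sum.inl i, Sum.inl j), by simpa using h⟩ := rfl

/-- An edge of `G₂` as an edge of the sum graph. -/
lemma edgeSetSumEquiv_symm_inr {i j : X₂} (h : s(i, j) ∈ G₂.edgeSet) :
    (SimpleGraph.edgeSetSumEquiv (G := G₁) (H := G₂)).symm (Sum.inr ⟨s(i, j), h⟩) =
      ⟨s(Sum.inr i, Sum.inr j), by simpa using h⟩ := rfl

/-- Glue two fibre points into a fibre point of the sum graph. -/
def glueKE (w₁ : FibKE X₁ G₁) (w₂ : FibKE X₂ G₂) : FibKE (X₁ ⊕ X₂) (G₁ ⊕g G₂) :=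
  (Sum.elim w₁.1 w₂.1,
    fun s => Sum.elim w₁.2.1 w₂.2.1 (SimpleGraph.edgeSetSumEquiv s),
    Sum.elim w₁.2.2 w₂.2.2)

/-- Split a fibre point of the sum graph into its two parts. -/
def splitKE (w : FibKE (X₁ ⊕ X₂) (G₁ ⊕g G₂)) : FibKE X₁ G₁ × FibKE X₂ G₂ :=
  ((fun i => w.1 (Sum.inl i),
      fun s => w.2.1 ((SimpleGraph.edgeSetSumEquiv (G := G₁) (H := G₂)).symm (Sum.inl s)),
      fun i => w.2.2 (Sum.inl i)),
    (fun i => w.1 (Sum.inr i),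
      fun s => w.2.1 ((SimpleGraph.edgeSetSumEquiv (G := G₁) (H := G₂)).symm (Sum.inr s)),
      fun i => w.2.2 (Sum.inr i)))

/-- Splitting a glued point gives the parts back. -/
lemma splitKE_glueKE (w₁ : FibKE X₁ G₁) (w₂ : FibKE X₂ G₂) :
    splitKE G₁ G₂ (glueKE G₁ G₂ w₁ w₂) = (w₁, w₂) := by
  obtain ⟨a₁, c₁, e₁⟩ := w₁
  obtain ⟨a₂, c₂, e₂⟩ := w₂
  simp only [splitKE, glueKE, Equiv.apply_symm_apply, Sum.elim_inl, Sum.elim_inr]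

/-- Gluing the parts of a point gives the point back. -/
lemma glueKE_splitKE (w : FibKE (X₁ ⊕ X₂) (G₁ ⊕g G₂)) :
    glueKE G₁ G₂ (splitKE G₁ G₂ w).1 (splitKE G₁ G₂ w).2 = w := by
  obtain ⟨a, c, e⟩ := w
  refine Prod.ext ?_ (Prod.ext ?_ ?_)
  · funext x; cases x <;> rfl
  · funext s
    show Sum.elim _ _ (SimpleGraph.edgeSetSumEquiv s) = c s
    rcases hs : SimpleGraph.edgeSetSumEquiv s with s₁ | s₂
    · show c ((SimpleGraph.edgeSetSumEquiv (G := G₁) (H := G₂)).symm (Sum.inl s₁)) = c s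
      rw [← hs, Equiv.symm_apply_apply]
    · show c ((SimpleGraph.edgeSetSumEquiv (G := G₁) (H := G₂)).symm (Sum.inr s₂)) = c s
      rw [← hs, Equiv.symm_apply_apply]
  · funext x; cases x <;> rfl

/-- The fibre points of the sum graph are the pairs of fibre points. -/
def glueEquivKE : FibKE X₁ G₁ × FibKE X₂ G₂ ≃ FibKE (X₁ ⊕ X₂) (G₁ ⊕g G₂) where
  toFun x := glueKE G₁ G₂ x.1 x.2
  invFun := splitKE G₁ G₂
  left_inv x := splitKE_glueKE G₁ G₂ x.1 x.2
  right_inv := glueKE_splitKE G₁ G₂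

/-- The flip commutes with the gluing. -/
lemma glueKE_flip (w₁ : FibKE X₁ G₁) (w₂ : FibKE X₂ G₂) :
    glueKE G₁ G₂ w₁.flip w₂.flip = (glueKE G₁ G₂ w₁ w₂).flip := by
  refine Prod.ext ?_ (Prod.ext ?_ ?_)
  · funext x; cases x <;> rfl
  · funext s
    show Sum.elim _ _ (SimpleGraph.edgeSetSumEquiv s) = !(Sum.elim _ _ (SimpleGraph.edgeSetSumEquiv s))
    rcases SimpleGraph.edgeSetSumEquiv s with s₁ | s₂ <;> rfl
  · funext x; cases x <;> rfl

end Glue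

section Link

variable {X₁ X₂ : Type*} (G₁ : SimpleGraph X₁) (G₂ : SimpleGraph X₂)
  (w₁ : FibKE X₁ G₁) (w₂ : FibKE X₂ G₂)

/-- The projection of the link vertices of the sum onto those of the first part: `u` and the
second part go to `u`. -/
def projL : Option (X₁ ⊕ X₂) → Option X₁
  | none => none
  | some (Sum.inl i) => some i
  | some (Sum.inr _) => none

/-- The projection onto the second part. -/
def projR : Option (X₁ ⊕ X₂) → Option X₂
  | none => none
  | some (Sum.inl _) => none
  | some (Sum.inr i) => some i

/-- Adjacent link vertices of the sum project to equal or adjacent link vertices of `G₁`. -/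
lemma adj_projL {x y : Option (X₁ ⊕ X₂)} (h : (GlinkE (G₁ ⊕g G₂) (glueKE G₁ G₂ w₁ w₂)).Adj x y) :
    projL x = projL y ∨ (GlinkE G₁ w₁).Adj (projL x) (projL y) := by
  rcases x with _ | (i | i) <;> rcases y with _ | (j | j)
  · exact absurd h id
  · exact Or.inr h
  · exact Or.inl rfl
  · exact Or.inr h
  · obtain ⟨hij, hc⟩ := h
    exact Or.inr ⟨SimpleGraph.sum_adj_inl.1 hij, hc⟩
  · obtain ⟨hij, -⟩ := h
    exact absurd hij (SimpleGraph.not_adj_sum_inl_inr _ _)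
  · exact Or.inl rfl
  · obtain ⟨hij, -⟩ := h
    exact absurd hij.symm (SimpleGraph.not_adj_sum_inl_inr _ _)
  · exact Or.inl rfl

/-- Adjacent link vertices of the sum project to equal or adjacent link vertices of `G₂`. -/
lemma adj_projR {x y : Option (X₁ ⊕ X₂)} (h : (GlinkE (G₁ ⊕g G₂) (glueKE G₁ G₂ w₁ w₂)).Adj x y) :
    projR x = projR y ∨ (GlinkE G₂ w₂).Adj (projR x) (projR y) := by
  rcases x with _ | (i | i) <;> rcases y with _ | (j | j)
  · exact absurd h id
  · exact Or.inl rfl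
  · exact Or.inr h
  · exact Or.inl rfl
  · exact Or.inl rfl
  · obtain ⟨hij, -⟩ := h
    exact absurd hij (SimpleGraph.not_adj_sum_inl_inr _ _)
  · exact Or.inr h
  · obtain ⟨hij, -⟩ := h
    exact absurd hij.symm (SimpleGraph.not_adj_sum_inl_inr _ _)
  · obtain ⟨hij, hc⟩ := h
    exact Or.inr ⟨SimpleGraph.sum_adj_inr.1 hij, hc⟩

/-- Adjacent link vertices of `G₁` embed into adjacent link vertices of the sum. -/
lemma adj_embL {x y : Option X₁} (h : (GlinkE G₁ w₁).Adj x y) :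
    (GlinkE (G₁ ⊕g G₂) (glueKE G₁ G₂ w₁ w₂)).Adj (x.map Sum.inl) (y.map Sum.inl) := by
  rcases x with _ | i <;> rcases y with _ | j
  · exact absurd h id
  · exact h
  · exact h
  · obtain ⟨hij, hc⟩ := h
    exact ⟨SimpleGraph.sum_adj_inl.2 hij, hc⟩

/-- Adjacent link vertices of `G₂` embed into adjacent link vertices of the sum. -/
lemma adj_embR {x y : Option X₂} (h : (GlinkE G₂ w₂).Adj x y) :
    (GlinkE (G₁ ⊕g G₂) (glueKE G₁ G₂ w₁ w₂)).Adj (x.map Sum.inr) (y.map Sum.inr) := by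
  rcases x with _ | i <;> rcases y with _ | j
  · exact absurd h id
  · exact h
  · exact h
  · obtain ⟨hij, hc⟩ := h
    exact ⟨SimpleGraph.sum_adj_inr.2 hij, hc⟩

/-- Reachability in the link graph of the sum projects to the first part. -/
lemma reachable_projL {x y : Option (X₁ ⊕ X₂)}
    (h : (GlinkE (G₁ ⊕g G₂) (glueKE G₁ G₂ w₁ w₂)).Reachable x y) :
    (GlinkE G₁ w₁).Reachable (projL x) (projL y) :=
  reachable_of_adj_imp projL (fun _ _ => adj_projL G₁ G₂ w₁ w₂) h

/-- Reachability in the link graph of the sum projects to the second part. -/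
lemma reachable_projR {x y : Option (X₁ ⊕ X₂)}
    (h : (GlinkE (G₁ ⊕g G₂) (glueKE G₁ G₂ w₁ w₂)).Reachable x y) :
    (GlinkE G₂ w₂).Reachable (projR x) (projR y) :=
  reachable_of_adj_imp projR (fun _ _ => adj_projR G₁ G₂ w₁ w₂) h

/-- Reachability in the link graph of `G₁` embeds into the sum. -/
lemma reachable_embL {x y : Option X₁} (h : (GlinkE G₁ w₁).Reachable x y) :
    (GlinkE (G₁ ⊕g G₂) (glueKE G₁ G₂ w₁ w₂)).Reachable (x.map Sum.inl) (y.map Sum.inl) :=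
  reachable_of_adj_imp (Option.map Sum.inl) (fun _ _ h => Or.inr (adj_embL G₁ G₂ w₁ w₂ h)) h

/-- Reachability in the link graph of `G₂` embeds into the sum. -/
lemma reachable_embR {x y : Option X₂} (h : (GlinkE G₂ w₂).Reachable x y) :
    (GlinkE (G₁ ⊕g G₂) (glueKE G₁ G₂ w₁ w₂)).Reachable (x.map Sum.inr) (y.map Sum.inr) :=
  reachable_of_adj_imp (Option.map Sum.inr) (fun _ _ h => Or.inr (adj_embR G₁ G₂ w₁ w₂ h)) h

/-- A vertex of the first part is attached in the sum iff it is attached in `G₁`. -/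
lemma attE_glue_inl (i : X₁) : attE (G₁ ⊕g G₂) (glueKE G₁ G₂ w₁ w₂) (Sum.inl i) ↔ attE G₁ w₁ i :=
  ⟨fun h => reachable_projL G₁ G₂ w₁ w₂ h, fun h => reachable_embL G₁ G₂ w₁ w₂ h⟩

/-- A vertex of the second part is attached in the sum iff it is attached in `G₂`. -/
lemma attE_glue_inr (i : X₂) : attE (G₁ ⊕g G₂) (glueKE G₁ G₂ w₁ w₂) (Sum.inr i) ↔ attE G₂ w₂ i :=
  ⟨fun h => reachable_projR G₁ G₂ w₁ w₂ h, fun h => reachable_embR G₁ G₂ w₁ w₂ h⟩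

/-- Two vertices of the first part are linked in the sum iff they are linked in `G₁`. -/
lemma rlinkE_glue_inl_inl (i j : X₁) :
    rlinkE (G₁ ⊕g G₂) (glueKE G₁ G₂ w₁ w₂) (Sum.inl i) (Sum.inl j) ↔ rlinkE G₁ w₁ i j :=
  ⟨fun h => reachable_projL G₁ G₂ w₁ w₂ h, fun h => reachable_embL G₁ G₂ w₁ w₂ h⟩

/-- Two vertices of the second part are linked in the sum iff they are linked in `G₂`. -/
lemma rlinkE_glue_inr_inr (i j : X₂) :
    rlinkE (G₁ ⊕g G₂) (glueKE G₁ G₂ w₁ w₂) (Sum.inr i) (Sum.inr j) ↔ rlinkE G₂ w₂ i j :=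
  ⟨fun h => reachable_projR G₁ G₂ w₁ w₂ h, fun h => reachable_embR G₁ G₂ w₁ w₂ h⟩

/-- A vertex of the first part and a vertex of the second part are linked in the sum iff both
are attached: the link passes through `u`. -/
lemma rlinkE_glue_inl_inr (i : X₁) (j : X₂) :
    rlinkE (G₁ ⊕g G₂) (glueKE G₁ G₂ w₁ w₂) (Sum.inl i) (Sum.inr j) ↔ attE G₁ w₁ i ∧ attE G₂ w₂ j := by
  constructor
  · intro h
    exact ⟨reachable_projL G₁ G₂ w₁ w₂ h, (reachable_projR G₁ G₂ w₁ w₂ h).symm⟩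
  · rintro ⟨h₁, h₂⟩
    exact (reachable_embL G₁ G₂ w₁ w₂ h₁).trans (reachable_embR G₁ G₂ w₁ w₂ h₂).symm

/-- The mirror of `rlinkE_glue_inl_inr`. -/
lemma rlinkE_glue_inr_inl (i : X₂) (j : X₁) :
    rlinkE (G₁ ⊕g G₂) (glueKE G₁ G₂ w₁ w₂) (Sum.inr i) (Sum.inl j) ↔ attE G₂ w₂ i ∧ attE G₁ w₁ j := by
  rw [rlinkE, SimpleGraph.reachable_comm]
  exact (rlinkE_glue_inl_inr G₁ G₂ w₁ w₂ j i).trans and_comm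

end Link

section Fibre

variable {X₁ X₂ : Type*} (G₁ : SimpleGraph X₁) (G₂ : SimpleGraph X₂)
  (w₁ : FibKE X₁ G₁) (w₂ : FibKE X₂ G₂)

/-- The red-side leak of the glued point is the disjunction of the leaks. -/
lemma leakKE_glue : leakKE (G₁ ⊕g G₂) (glueKE G₁ G₂ w₁ w₂) = (leakKE G₁ w₁ || leakKE G₂ w₂) := by
  simp only [leakKE]
  rw [← Bool.decide_or, decide_eq_decide]
  constructor
  · rintro ⟨x, hx, he⟩
    rcases x with i | i
    · exact Or.inl ⟨i, (attE_glue_inl G₁ G₂ w₁ w₂ i).1 hx, he⟩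
    · exact Or.inr ⟨i, (attE_glue_inr G₁ G₂ w₁ w₂ i).1 hx, he⟩
  · rintro (⟨i, hi, he⟩ | ⟨i, hi, he⟩)
    · exact ⟨Sum.inl i, (attE_glue_inl G₁ G₂ w₁ w₂ i).2 hi, he⟩
    · exact ⟨Sum.inr i, (attE_glue_inr G₁ G₂ w₁ w₂ i).2 hi, he⟩

/-- The red edge atom of a vertex of the first part. -/
lemma redKEE_glue_inl (i : X₁) :
    redKEE (G₁ ⊕g G₂) (glueKE G₁ G₂ w₁ w₂) (Sum.inl (Sum.inl i)) = redKEE G₁ w₁ (Sum.inl i) := rfl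

/-- The red edge atom of a vertex of the second part. -/
lemma redKEE_glue_inr (i : X₂) :
    redKEE (G₁ ⊕g G₂) (glueKE G₁ G₂ w₁ w₂) (Sum.inl (Sum.inr i)) = redKEE G₂ w₂ (Sum.inl i) := rfl

/-- The red edge atom of a cross edge of the first part. -/
lemma redKEE_glue_edge_inl (s : G₁.edgeSet) :
    redKEE (G₁ ⊕g G₂) (glueKE G₁ G₂ w₁ w₂)
        (Sum.inr ((SimpleGraph.edgeSetSumEquiv (G := G₁) (H := G₂)).symm (Sum.inl s))) =
      redKEE G₁ w₁ (Sum.inr s) := by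
  obtain ⟨e, he⟩ := s
  induction e using Sym2.ind with
  | h i j =>
    simp only [redKEE, glueKE, Equiv.apply_symm_apply, Sum.elim_inl, decide_eq_decide]
    rw [edgeSetSumEquiv_symm_inl]
    simp only [Sym2.mem_iff]
    constructor
    · rintro ⟨hc, x, hx, hatt⟩
      refine ⟨hc, ?_⟩
      rcases hx with rfl | rfl
      · exact ⟨i, Or.inl rfl, (attE_glue_inl G₁ G₂ w₁ w₂ i).1 hatt⟩
      · exact ⟨j, Or.inr rfl, (attE_glue_inl G₁ G₂ w₁ w₂ j).1 hatt⟩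
    · rintro ⟨hc, x, hx, hatt⟩
      refine ⟨hc, ?_⟩
      rcases hx with rfl | rfl
      · exact ⟨Sum.inl x, Or.inl rfl, (attE_glue_inl G₁ G₂ w₁ w₂ x).2 hatt⟩
      · exact ⟨Sum.inl x, Or.inr rfl, (attE_glue_inl G₁ G₂ w₁ w₂ x).2 hatt⟩

/-- The red edge atom of a cross edge of the second part. -/
lemma redKEE_glue_edge_inr (s : G₂.edgeSet) :
    redKEE (G₁ ⊕g G₂) (glueKE G₁ G₂ w₁ w₂)
        (Sum.inr ((SimpleGraph.edgeSetSumEquiv (G := G₁) (H := G₂)).symm (Sum.inr s))) =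
      redKEE G₂ w₂ (Sum.inr s) := by
  obtain ⟨e, he⟩ := s
  induction e using Sym2.ind with
  | h i j =>
    simp only [redKEE, glueKE, Equiv.apply_symm_apply, Sum.elim_inr, decide_eq_decide]
    rw [edgeSetSumEquiv_symm_inr]
    simp only [Sym2.mem_iff]
    constructor
    · rintro ⟨hc, x, hx, hatt⟩
      refine ⟨hc, ?_⟩
      rcases hx with rfl | rfl
      · exact ⟨i, Or.inl rfl, (attE_glue_inr G₁ G₂ w₁ w₂ i).1 hatt⟩
      · exact ⟨j, Or.inr rfl, (attE_glue_inr G₁ G₂ w₁ w₂ j).1 hatt⟩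
    · rintro ⟨hc, x, hx, hatt⟩
      refine ⟨hc, ?_⟩
      rcases hx with rfl | rfl
      · exact ⟨Sum.inr x, Or.inl rfl, (attE_glue_inr G₁ G₂ w₁ w₂ x).2 hatt⟩
      · exact ⟨Sum.inr x, Or.inr rfl, (attE_glue_inr G₁ G₂ w₁ w₂ x).2 hatt⟩

end Fibre

end CrossArm

end Summit.Ventures.PercRepro2
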